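import Literature.Probability.Percolation.QuadCrossingNullFrontier
import HarnessLib

/-!
# Line `registered`, stub: strict domination survives a small stretch of the square
(`stub_strictlyDominated_stretch`)

Crux `Summit.CriticalPhenomena.CardyFormulaZ2.Theses.CardyBondTriangular.DiscretisationBridge`
(stmt-CriticalPhenomena-0787), line `registered`, stub `stub_strictlyDominated_stretch`: if the
square `Q₀ = H ∘ rectMap 1 1` (read through a plane homeomorphism `H`) is strictly dominated by a
quad `Q''` in Schramm–Smirnov's order `<` on `𝒬_ℂ`, then so is the longer-and-narrower rectangle
`H ∘ rectMap (1 + s) (1 - s)` for some `s ∈ (0, 1/2]`.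

Proof: `<` is an open condition (the lower section `{Q : Q < Q''}` is open,
`Quad.isOpen_setOf_strictlyDominated_left`), so it contains a ball around `Q₀`; and
`H ∘ rectMap a b → Q₀` uniformly as `(a, b) → (1, 1)` (`Quad.exists_rect_near`).

References: O. Schramm, S. Smirnov, *On the scaling limits of planar percolation*, Ann. Probab. 39
(2011), §1.3 and proof of Lemma 5.1.
-/

namespace Summit.CriticalPhenomena.CardyFormulaZ2.Cruxes.DiscretisationBridge.Birth

open Set Metric Filter Topology
open scoped unitInterval
open Literature.Probability.Percolation Literature.Probability.Percolation.QuadCrossing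

/-- **Stub of line `registered` (stretching the square keeps `Q₀ < Q''`).** If the square quad
`Quad.rectQuad H 1 1` is strictly dominated by `Q''`, then for some `s ∈ (0, 1/2]` (so `s < 1`)
the longer-and-narrower rectangle `Quad.rectQuad H (1 + s) (1 - s)` is still strictly dominated by
`Q''`: the lower section `{Q : Q < Q''}` is open, hence contains a ball around the square, and the
rectangles `H ∘ rectMap a b` converge uniformly to the square as `(a, b) → (1, 1)`.
[cite: SchrammSmirnov2011, §1.3 and proof of Lemma 5.1] -/
theorem stub_strictlyDominated_stretch :
    ∀ (H : ℂ ≃ₜ ℂ) (Q'' : Literature.Probability.Percolation.QuadCrossing.Quad (Set.univ : Set ℂ)),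
      Literature.Probability.Percolation.QuadCrossing.Quad.StrictlyDominated
          (Literature.Probability.Percolation.QuadCrossing.Quad.rectQuad H 1 1 one_pos one_pos
            (fun _ => Set.mem_univ _)) Q'' →
        ∃ (s : ℝ) (hs : 0 < s) (hs1 : s < 1), s ≤ 1 / 2 ∧
          Literature.Probability.Percolation.QuadCrossing.Quad.StrictlyDominated
            (Literature.Probability.Percolation.QuadCrossing.Quad.rectQuad H (1 + s) (1 - s)
              (add_pos one_pos hs) (sub_pos.2 hs1) (fun _ => Set.mem_univ _)) Q'' := by
  intro H Q'' h
  -- the lower section `{Q : Q < Q''}` is open and contains the square `Q₀`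
  have hU : IsOpen {Q : Quad (univ : Set ℂ) | Quad.StrictlyDominated Q Q''} :=
    Quad.isOpen_setOf_strictlyDominated_left Q''
  obtain ⟨ε, hε, hball⟩ := Metric.isOpen_iff.1 hU _ h
  -- rectangles near the square are uniformly `ε/2`-close to it
  obtain ⟨τ, hτ, hτ2, hroom⟩ := Quad.exists_rect_near isOpen_univ
    (Quad.rectQuad H 1 1 one_pos one_pos (fun _ => mem_univ _)) H (fun p => rfl) (half_pos hε)
  have hτ1 : τ < 1 := by linarith
  refine ⟨τ, hτ, hτ1, hτ2, hball ?_⟩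
  have ha : |1 + τ - 1| ≤ τ := by
    rw [add_sub_cancel_left, abs_of_pos hτ]
  have hb : |1 - τ - 1| ≤ τ := by
    rw [sub_sub_cancel_left, abs_neg, abs_of_pos hτ]
  have hpt := (hroom (1 + τ) (1 - τ) ha hb).2
  rw [mem_ball]
  calc dist (Quad.rectQuad H (1 + τ) (1 - τ) (add_pos one_pos hτ) (sub_pos.2 hτ1)
          (fun _ => mem_univ _)) (Quad.rectQuad H 1 1 one_pos one_pos (fun _ => mem_univ _))
        ≤ ε / 2 := by
        rw [Quad.dist_eq, ContinuousMap.dist_le_iff_of_nonempty]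
        exact fun p => (hpt p).le
    _ < ε := half_lt_self hε

end Summit.CriticalPhenomena.CardyFormulaZ2.Cruxes.DiscretisationBridge.Birth
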